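import Literature.Analysis.FluidPDE.TaoCascadeDuhamel
import Literature.Analysis.FluidPDE.TaoCascadeMotion
import HarnessLib

/-!
# `PerpetualPump.PumpTransfer` (stmt-NavierStokesRegularity-1837), line `Sketch`, stub `stub_modeCoeff_of_bandField`

Registered stub of the lead's skeleton `Cruxes/PumpTransfer/Lines/Sketch.lean` (lead prover
prover-line-stmt-NavierStokesRegularity-1837-0). The wavelet coefficients of a band-structured field are the fibre averages.

Vocabulary: Tao's cascade operator (4.1) with wavelet data `𝒟 : CascadeWaveletData ε₀ m`
(`Literature/Analysis/FluidPDE/TaoCascadeOperator.lean`), the heat fibres `duhamelScalar δ Qr L t`,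
weights `modeWeight 𝒟 i n = |ψ̂_{i,n}|²` and `modeDelta` (`TaoCascadeDuhamel.lean`), `heatRate ξ = 4π²|ξ|²`
(`TaoBandHeatGroup.lean`), the circuit nonlinearity `TaoCascade.quadTerm` (`TaoCascadeODE.lean`).

## References

* T. Tao, J. Amer. Math. Soc. 29 (2016), 601–674 = arXiv:1402.0290v3, §4 Lemma 4.1 (4.14). [`Tao2016AveragedNS`]
-/

noncomputable section

-- the nested summit namespace is the tree's layout (D-0017)
set_option linter.dupNamespace false

namespace Summit.NavierStokesRegularity.NavierStokesRegularity.Theorems.PerpetualPumpPumpTransfer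

open MeasureTheory Set Filter Topology
open scoped ENNReal SchwartzMap
open Literature.Analysis Literature.Analysis.FluidPDE Literature.Analysis.FluidPDE.Tao2016

/-- **Stub `stub_modeCoeff_of_bandField`.** The wavelet coefficients of a band-structured field are the fibre averages:
if `v̂ = ∑_{(j,k)} φ_{j,k} ψ̂_{j,k}` a.e. with scalar fibres `φ_{j,k}(ξ) = duhamelScalar … (heatRate ξ) t`, then
`Re⟨v, ψ_{i,n}⟩ = ∫ φ_{i,n}(ξ) |ψ̂_{i,n}(ξ)|² dξ`. Proof: Parseval against the real wavelet
(`pairing_eq_integral_fourierFn`); for a.e. `ξ` only the term `(j,k) = (i,n)` of the band sum survives against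
`ψ̂_{i,n}(ξ)` (disjoint frequency regions, `CascadeWaveletData.not_mem_freqRegion_of_ne`,
`fourierFn_cascadeWavelet_eq_zero`), and `⟪ψ̂, φ • ψ̂⟫ = φ |ψ̂|²`; the real integrand is pulled out of `ℂ` by
`integral_complex_ofReal` (no integrability needed, so the continuity and `t ≥ 0` hypotheses are not used). -/
theorem stub_modeCoeff_of_bandField :
    ∀ (ε₀ : ℝ), 0 < ε₀ → ε₀ < 1 → ∀ (m : ℕ) (𝒟 : CascadeWaveletData ε₀ m)
    (α : Fin m → Fin m → Fin m → ℤ × ℤ × ℤ → ℝ) (i₀ : Fin m) (n₀ : ℤ) (A : ℝ)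
    (X : Fin m → ℤ → ℝ → ℝ) (t : ℝ) (v : L2C),
    (∀ (i : Fin m) (n : ℤ), Continuous (X i n)) → 0 ≤ t →
    (fourierFn v =ᵐ[volume] fun ξ => ∑' p : Fin m × ℤ,
      ((duhamelScalar (A * modeDelta i₀ p.1 n₀ p.2)
          (fun s => TaoCascade.quadTerm ε₀ α X p.1 p.2 (max s 0)) (heatRate ξ) t : ℝ) : ℂ) •
        fourierFn (cascadeWavelet ε₀ (𝒟.ψ p.1) p.2) ξ) →
    ∀ (i : Fin m) (n : ℤ), (pairing v (cascadeWavelet ε₀ (𝒟.ψ i) n)).re =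
      ∫ ξ : EuclideanSpace ℝ (Fin 3),
        duhamelScalar (A * modeDelta i₀ i n₀ n)
          (fun s => TaoCascade.quadTerm ε₀ α X i n (max s 0)) (heatRate ξ) t * modeWeight 𝒟 i n ξ := by
  intro ε₀ hε₀ _hε₁ m 𝒟 α i₀ n₀ A X t v _hX _ht hv i n
  have hε' : 0 < 1 + ε₀ := by linarith
  have hψreal : IsReal (cascadeWavelet ε₀ (𝒟.ψ i) n) := isReal_cascadeWavelet ε₀ (𝒟.ψ i) n
  -- all the wavelets vanish (a.e., simultaneously) off their frequency regions
  have hzero : ∀ᵐ ξ ∂(volume : Measure (EuclideanSpace ℝ (Fin 3))), ∀ p : Fin m × ℤ,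
      ξ ∉ freqRegion 𝒟 p.1 p.2 → fourierFn (cascadeWavelet ε₀ (𝒟.ψ p.1) p.2) ξ = 0 :=
    ae_all_iff.2 fun p => 𝒟.fourierFn_cascadeWavelet_eq_zero hε' p.1 p.2
  -- Parseval against the real wavelet: `⟨v, ψ_{i,n}⟩ = ∫ ⟪ψ̂_{i,n}(ξ), v̂(ξ)⟫ dξ`
  rw [pairing_eq_integral_fourierFn hψreal]
  -- a.e. only the term `p = (i,n)` of the band sum survives against `ψ̂_{i,n}`
  have key : ∀ᵐ ξ ∂(volume : Measure (EuclideanSpace ℝ (Fin 3))),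
      inner ℂ (fourierFn (cascadeWavelet ε₀ (𝒟.ψ i) n) ξ) (fourierFn v ξ) =
        ((duhamelScalar (A * modeDelta i₀ i n₀ n)
            (fun s => TaoCascade.quadTerm ε₀ α X i n (max s 0)) (heatRate ξ) t *
              modeWeight 𝒟 i n ξ : ℝ) : ℂ) := by
    filter_upwards [hv, hzero] with ξ h1 h2
    rw [h1]
    by_cases hξ : ξ ∈ freqRegion 𝒟 i n
    · rw [tsum_eq_single (i, n) (fun p hp => ?_)]
      · rw [inner_smul_right, inner_self_eq_norm_sq_to_K, modeWeight]
        push_cast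
        congr 1
      · obtain ⟨j, k⟩ := p
        have h3 : fourierFn (cascadeWavelet ε₀ (𝒟.ψ j) k) ξ = 0 :=
          h2 (j, k) (𝒟.not_mem_freqRegion_of_ne hε₀ (Ne.symm hp) hξ)
        simp only [h3, smul_zero]
    · have h3 : fourierFn (cascadeWavelet ε₀ (𝒟.ψ i) n) ξ = 0 := h2 (i, n) hξ
      simp [modeWeight, h3]
  rw [integral_congr_ae key, integral_complex_ofReal, Complex.ofReal_re]

end Summit.NavierStokesRegularity.NavierStokesRegularity.Theorems.PerpetualPumpPumpTransfer

end
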